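import Mathlib
import HarnessLib
import Summits.HubbardSuperconductivity.HubbardSuperconductivity.Theorems.KLProgrammeKLRegimeSplitEdgeFactsCrossingColumns
import Summits.HubbardSuperconductivity.HubbardSuperconductivity.Theorems.KLProgrammeKLRegimeSplitEdgeFactsLevelSetFloorColumnsV

/-!
# Route `KLProgramme` — edge facts for the pair masses ACROSS TRANSFERS, XVI′: the crossing-columns floor (row 30 `…CrossingColumns` §3) with an ABSTRACT first-jet
# constant `v` — `kllcv_levelSet_card_ge_of_criterion`: `#{a : criterion}·((B − A)L/(2πv) − 1) ≤ #{k⃗ : A ≤ e_K ≤ B}`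

Cell gate-hubbard-kl, seat hubbard-kl-k3c1-p1 (g22; child-1 lineage); cure of the located «(s2)-JETS-COEFFNORM-KEYING».  Row 30's §1–§2 (column bottom/top through
`coeffNorm 0 K`, which IS n-flat for the flow frames: `coeffNorm 0 K_n ≤ 1370·cr|U|·e₀`, `…VolumeLimitFlowFramesCoeffNorm`) are imported unchanged; only §3, which
consumes row 29's vertical step `(4 + coeffNorm 1 K)·2π/L`, is re-proved over the abstract forward jet (`…LevelSetFloorColumnsV`; section hypotheses `hjet`, `hjv`).
Everything is proved; no definitions; nothing asserts any slot, stub, K3 or SC. [folklore]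
-/

noncomputable section

namespace Summit.HubbardSuperconductivity.HubbardSuperconductivity.Theorems.KLRegimeSplit

set_option linter.dupNamespace false -- summit = problem name (single-conjunct summit), D-0017

open Real Finset Literature.MathematicalPhysics.QuantumLattice Literature.Probability.LatticeModels
open Summit.HubbardSuperconductivity.HubbardSuperconductivity.Theorems.KLProgrammeLegKernels

/-! ## §1 The band at the two ends of a column -/

section Columns

variable {L : ℕ} [NeZero L] (μ : ℝ) (K : TrigPolyC4v)
variable {v κ : ℝ}
  (hjet : (∀ k Q : TorusSite 2 L, |nambuXiCT L μ K (k + Q) - nambuXiCT L μ K k| ≤ v * klTorusNorm L Q) ∧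
    (∀ k Q : TorusSite 2 L, |nambuXiCT L μ K (k - Q) - nambuXiCT L μ K k| ≤ v * klTorusNorm L Q) ∧
      ∀ k Q : TorusSite 2 L, |nambuXiCT L μ K (k + Q) - 2 * nambuXiCT L μ K k + nambuXiCT L μ K (k - Q)| ≤ κ * klTorusNorm L Q ^ 2)
  (hjv : 4 ≤ v) (hjκ : 4 ≤ κ)
include hjet hjv hjκ

/-! ## §2 The crossing criterion -/

/-! ## §3 The level-set floor with the explicit column set -/

omit hjκ in
/-- **Level-set floor from the column criterion**: with `C = {a : −2cos(2πa/L) − 2 − μ + coeffNorm 0 K < A ∧ B < −2cos(2πa/L) + 2cos(π/L) − μ − coeffNorm 0 K}`,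
`#C·((B − A)L/(2πv) − 1) ≤ #{k⃗ : A ≤ e_K(p_k⃗) ≤ B}` (`A ≤ B`). [folklore] -/
theorem kllcv_levelSet_card_ge_of_criterion {A B : ℝ} (hAB : A ≤ B) :
    (((univ : Finset (ZMod L)).filter fun a =>
          -2 * Real.cos (2 * π * (a.val : ℝ) / L) - 2 - μ + K.coeffNorm 0 < A ∧
            B < -2 * Real.cos (2 * π * (a.val : ℝ) / L) + 2 * Real.cos (π / L) - μ - K.coeffNorm 0).card : ℝ) *
        ((B - A) * L / (2 * π * v) - 1) ≤
      (((univ : Finset (TorusSite 2 L)).filter fun k => A ≤ nambuXiCT L μ K k ∧ nambuXiCT L μ K k ≤ B).card : ℝ) := by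
  classical
  refine kllfv_levelSet_card_ge μ K hjet hjv hAB _ fun a ha => ?_
  obtain ⟨-, h1, h2⟩ := mem_filter.1 ha
  exact kllc_column_crosses μ K a h1 h2

end Columns

end Summit.HubbardSuperconductivity.HubbardSuperconductivity.Theorems.KLRegimeSplit

end

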